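import Summits.BirchSwinnertonDyer.Rank1Residual.Additive.AdicCompletionGaloisConj
import Literature.NumberTheory.EllipticCurves.LocalRestrictionDegree
import HarnessLib

/-!
# T-res (second half), file B: every `K`-embedding of `L` into an algebraically closed
# `K_v`-field factors through a completion `L_w`, `w ∣ v` (cell `b2b-bsdres`, n1011, p17 GEN 4;
# r2 ROUTE-2 §II.17.7 T-res)

HONEST FRAMING (cell `b2b-bsdres`, verbatim in every file): prove what is provable now; nothing is
booked; no label changes. Infrastructure (Galois theory of completions of number fields); THEOREMS
only; NO Literature fact; no `sorry`.

For a finite Galois extension of number fields `L/K`, a finite place `v` of `K`, a field `Ω` that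
is algebraically closed and a ring homomorphism `ι_v : K_v → Ω`:

* `exists_place_factorisation` : every ring homomorphism `φ : L → Ω` with
  `φ|_K = ι_v|_K` is of the form `ε ∘ (L → L_w)` for some finite place `w ∣ v` of `L` and some ring
  homomorphism `ε : L_w → Ω` with `ε ∘ (K_v → L_w) = ι_v` — i.e. the `K`-embeddings of `L` into
  `Ω ⊇ K_v` are accounted for by the places of `L` above `v` (the easy half of
  `Hom_K(L, K̄_v) = ∐_{w ∣ v} Hom_{K_v}(L_w, K̄_v)`).

No valuation on `Ω` and no counting is used: one `K_v`-embedding `ε₀ : L_{w₀} → Ω` at one place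
`w₀ ∣ v` exists because `L_{w₀}/K_v` is finite (Mathlib's instance `Module.Finite K_v L_w`) and `Ω`
is algebraically closed (`IsAlgClosed.lift`); by normality of `L/K` any `φ` is `ε₀ ∘ (L → L_{w₀}) ∘ g`
for some `g ∈ Gal(L/K)` (`exists_algEquiv_eq_comp`, Mathlib `AlgHom.restrictNormal'`); and
`(L → L_{w₀}) ∘ g = ĝ ∘ (L → L_{g⁻¹ w₀})` for the completed conjugation `ĝ` of file A
(`adicCompletionConj`).

References: [NeukirchANT1999] II.§8 (extensions of valuations; `L ⊗_K K_v = ∏_{w ∣ v} L_w`);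
[SerreLocalFields1979] II.§3.
-/

noncomputable section

open scoped Classical Pointwise

open NumberField IsDedekindDomain Literature.NumberTheory.EllipticCurves

universe u

namespace Summit.BirchSwinnertonDyer.Rank1Residual.Additive.LocalTransport

variable {K : Type u} [Field K] {L : Type u} [Field L] [Algebra K L]

/-! ## Two `K`-embeddings of a normal extension differ by an automorphism -/

/-- For `L/K` normal, two `K`-algebra maps `φ₀, φ : L → Ω` into a field differ by a
`K`-automorphism of `L`: `φ = φ₀ ∘ g` (Mathlib `AlgHom.restrictNormal'` for the tower
`K ≤ L ≤ Ω` defined by `φ₀`; the argument of the tree's `exists_algHom_eq_comp`).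
[cite: SerreLocalFields1979, II.§3] -/
theorem exists_algEquiv_eq_comp [Normal K L] {Ω : Type*} [Field Ω] [Algebra K Ω]
    (φ₀ φ : L →ₐ[K] Ω) : ∃ g : L ≃ₐ[K] L, φ = φ₀.comp (g : L →ₐ[K] L) := by
  letI : Algebra L Ω := φ₀.toRingHom.toAlgebra
  haveI : IsScalarTower K L Ω :=
    IsScalarTower.of_algebraMap_eq fun x ↦ (φ₀.commutes x).symm
  refine ⟨φ.restrictNormal' L, AlgHom.ext fun x ↦ ?_⟩
  have h := AlgHom.restrictNormal_commutes φ L x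
  exact h.symm

/-! ## Factorisation of embeddings through completions -/

section Factorisation

variable [NumberField K] [NumberField L] (L)

/-- **At one place `w ∣ v` there is a `K_v`-embedding `L_w → Ω`** for `Ω ⊇ K_v` algebraically
closed: `L_w` is finite over `K_v` (Mathlib's instance `Module.Finite K_v L_w` for the continuous
`K_v`-algebra structure `adicCompletionMap`), so `IsAlgClosed.lift` applies.
[cite: NeukirchANT1999, II.§8] -/
theorem exists_ringHom_adicCompletion (v : HeightOneSpectrum (𝓞 K)) (w : HeightOneSpectrum (𝓞 L))
    [w.asIdeal.LiesOver v.asIdeal] {Ω : Type u} [Field Ω] [IsAlgClosed Ω]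
    (ιv : v.adicCompletion K →+* Ω) :
    ∃ ε : w.adicCompletion L →+* Ω, ε.comp (adicCompletionMap (K := K) L v w) = ιv := by
  letI : Algebra (v.adicCompletion K) (w.adicCompletion L) :=
    (adicCompletionMap (K := K) L v w).toAlgebra
  have hcoe : ∀ x : K, adicCompletionMap (K := K) L v w (algebraMap K (v.adicCompletion K) x) =
      algebraMap L (w.adicCompletion L) (algebraMap K L x) := fun x ↦
    adicCompletionMap_coe (K := K) L v w x
  haveI : IsScalarTower K (v.adicCompletion K) (w.adicCompletion L) :=
    IsScalarTower.of_algebraMap_eq fun x ↦ by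
      rw [RingHom.algebraMap_toAlgebra, hcoe, ← IsScalarTower.algebraMap_apply]
  haveI : ContinuousSMul (v.adicCompletion K) (w.adicCompletion L) :=
    ⟨((continuous_adicCompletionMap w v).comp continuous_fst).mul continuous_snd⟩
  haveI : Algebra.IsAlgebraic (v.adicCompletion K) (w.adicCompletion L) :=
    Algebra.IsAlgebraic.of_finite _ _
  letI : Algebra (v.adicCompletion K) Ω := ιv.toAlgebra
  let ε₀ : w.adicCompletion L →ₐ[v.adicCompletion K] Ω := IsAlgClosed.lift
  refine ⟨ε₀.toRingHom, ?_⟩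
  ext x
  exact ε₀.commutes x

/-- **Every `K`-embedding `L → Ω` into an algebraically closed field over `K_v` factors through a
completion `L_w`, `w ∣ v`, compatibly with `K_v`** (`L/K` Galois). With `ε₀ : L_{w₀} → Ω` at one
`w₀ ∣ v` (`exists_ringHom_adicCompletion`), `φ = ε₀ ∘ (L → L_{w₀}) ∘ g` for some `g ∈ Gal(L/K)`
(`exists_algEquiv_eq_comp`) and `(L → L_{w₀}) ∘ g = ĝ ∘ (L → L_w)` for `w = g⁻¹ w₀`
(`adicCompletionConj_coe`), with `ĝ` compatible with `K_v` (`adicCompletionConj_comp_adicCompletionMap`).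
[cite: NeukirchANT1999, II.§8] -/
theorem exists_place_factorisation [IsGalois K L] (v : HeightOneSpectrum (𝓞 K)) {Ω : Type u}
    [Field Ω] [IsAlgClosed Ω] (ιv : v.adicCompletion K →+* Ω) (φ : L →+* Ω)
    (hφ : φ.comp (algebraMap K L) = ιv.comp (algebraMap K (v.adicCompletion K))) :
    ∃ (w : HeightOneSpectrum (𝓞 L)) (_ : w.asIdeal.LiesOver v.asIdeal)
      (ε : w.adicCompletion L →+* Ω),
      ε.comp (adicCompletionMap (K := K) L v w) = ιv ∧
        ε.comp (algebraMap L (w.adicCompletion L)) = φ := by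
  obtain ⟨w₀, hw₀⟩ := exists_liesOver L v
  obtain ⟨ε₀, hε₀⟩ := exists_ringHom_adicCompletion L v w₀ ιv
  -- `Ω` as a `K`-algebra through `ι_v`; `φ` and `φ₀ = ε₀ ∘ (L → L_{w₀})` as `K`-algebra maps
  letI : Algebra K Ω := (ιv.comp (algebraMap K (v.adicCompletion K))).toAlgebra
  have hcoe : ∀ x : K, adicCompletionMap (K := K) L v w₀ (algebraMap K (v.adicCompletion K) x) =
      algebraMap L (w₀.adicCompletion L) (algebraMap K L x) := fun x ↦
    adicCompletionMap_coe (K := K) L v w₀ x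
  have hφ₀K : ∀ x : K, ε₀ (algebraMap L (w₀.adicCompletion L) (algebraMap K L x)) =
      ιv (algebraMap K (v.adicCompletion K) x) := fun x ↦ by
    rw [← hcoe x]
    exact RingHom.congr_fun hε₀ _
  let φ₀' : L →ₐ[K] Ω :=
    { ε₀.comp (algebraMap L (w₀.adicCompletion L)) with
      commutes' := fun x ↦ hφ₀K x }
  let φ' : L →ₐ[K] Ω :=
    { φ with
      commutes' := fun x ↦ RingHom.congr_fun hφ x }
  obtain ⟨g, hg⟩ := exists_algEquiv_eq_comp φ₀' φ'
  have hgl : ∀ l : L, φ l = ε₀ (algebraMap L (w₀.adicCompletion L) (g l)) := fun l ↦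
    congrArg (fun f : L →ₐ[K] Ω ↦ f l) hg
  -- the place `w = g⁻¹ w₀` and `ε = ε₀ ∘ ĝ`
  have hgw : g • (smulPlace g⁻¹ w₀).asIdeal = w₀.asIdeal := smul_smulPlace_inv_asIdeal g w₀
  haveI hw : (smulPlace g⁻¹ w₀).asIdeal.LiesOver v.asIdeal :=
    liesOver_of_smul_eq (g := g⁻¹) (w := w₀) v rfl
  refine ⟨smulPlace g⁻¹ w₀, hw, ε₀.comp (adicCompletionConj g _ w₀ hgw), ?_, ?_⟩
  · rw [RingHom.comp_assoc, adicCompletionConj_comp_adicCompletionMap, hε₀]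
  · ext l
    rw [RingHom.comp_apply, RingHom.comp_apply, hgl l]
    exact congrArg ε₀ (adicCompletionConj_coe g _ w₀ hgw l)

end Factorisation

end Summit.BirchSwinnertonDyer.Rank1Residual.Additive.LocalTransport

end
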